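import Summits.Ventures.YMGap.Conjectures.StrongCouplingChiralLROMesonWeightBackground
import Literature.MathematicalPhysics.QuantumLattice.StaggeredTranslationInvariance
import Literature.MathematicalPhysics.QuantumLattice.GrassmannLinearSubstitution
import HarnessLib
import HarnessLib.Audit.Tags

/-!
# Lattice symmetries of the meson moments (1/2): site relabellings of the fermion algebra, and
# translation invariance of `S_β(∏σ̂^m)`

Cell `pub-ymgap`, seat qcd-lit g21 (literature-prover), `bears_on: Q1`.  Everything is a theorem
(0 facts, 0 sorry).  This file discharges the translation hypothesis `hT` of
`…MesonWeightAllPlanes` / `…MesonWeightInfraredBound`.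

* **Site relabellings with a sign gauge** (`siteRelabel g s = ExteriorAlgebra.map (siteSubst g s)`, any
  site bijection `g` and sign function `s`): `ψ_a(x) ↦ s(x) ψ_a(gx)`, `ψ̄_a(x) ↦ s(x) ψ̄_a(gx)`; hence
  `ψ̄ψ(x) ↦ ψ̄ψ(gx)` when `s² = 1` (`siteRelabel_meson`), the hopping terms pick up `s(x)s(y)`
  (`siteRelabel_hopAt`), exponentials are respected (`map_grassmannExp_eq`), the Berezin integral is
  multiplied by `det` (`berezin_map`), and the bosonisation intertwines `rename g` (`siteRelabel_bos`).
* **Translations** (`g = · + c`, `s = ζ_c` the staggered shift sign of `StaggeredTranslationInvariance`,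
  `ζ_c(x)ζ_c(x+e_μ)η_μ(x) = η_μ(x+c)`): the massless periodic staggered action is carried to the action in
  the translated gauge field (`translateF_actionOn`), so by translation invariance of `∏dU` and of the
  plaquette weight `J_β(ρ_c G) = det ρ_c · J_β(G)` (`sdJ_translateF`), `det ρ_c = 1` (test on `G = 1`,
  `J_β(1) ≠ 0`), and **`w_β(m ∘ τ_c) = w_β(m)`** (`mesonMoment_mapDomain_addRight`).

Honest framing: finite even torus, periodic b.c., every real `β`, every `N`; nothing about the continuum
or the summit's `QCD` conjunct.

## References
* [MontvayMunster1994] I. Montvay, G. Münster, *Quantum Fields on a Lattice*, CUP 1994, §4.3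
  (4.186)–(4.187) (shift symmetry of staggered fermions).
* [SalmhoferSeiler1991] M. Salmhofer, E. Seiler, Commun. Math. Phys. 139 (1991) 395–432, §2 (2.3)–(2.4),
  (2.9)–(2.12), (3.100).
* [Berezin1966] F. A. Berezin, *The Method of Second Quantization*, 1966, Ch. I §3 (linear changes of
  generators).
-/

noncomputable section

open MeasureTheory Finset MvPolynomial
open scoped ComplexConjugate BigOperators
open Literature.MathematicalPhysics.QuantumFieldTheory (Site Edge GaugeConfig torusConfigShift torusEdgeShift
  torusConfigShift_apply torusEdgeShift_apply wilsonAction_torusConfigShift)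
open Literature.MathematicalPhysics.QuantumLattice
open Literature.MathematicalPhysics.QuantumLattice.GrassmannAlgebra
open Literature.MathematicalPhysics.QuantumLattice.StrongCoupling
open Literature.MathematicalPhysics.QuantumLattice.StaggeredRP (idxSite)
open Literature.MathematicalPhysics.QuantumLattice.StaggeredShift (shiftSign phase_add_eq_shiftSign_mul cast_shiftSign_mul_self)
open Literature.MathematicalPhysics.StatisticalMechanics
open Literature.MathematicalPhysics.StatisticalMechanics.ComplexSpin
open Literature.Probability.LatticeModels (TorusSite)

namespace Summit.Ventures.YMGap.Conjectures

namespace MesonWeight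

open SchwingerDyson

/-! ### Site relabellings of the fermion algebra with a sign gauge -/

section Relabel

variable {Λ : Type*} [LinearOrder Λ] {N : ℕ}

/-- The map of generator indices induced by a site map `g`: `ψ̄_a(x) ↦ ψ̄_a(gx)`, `ψ_a(x) ↦ ψ_a(gx)`. [cite: Berezin1966, Ch. I §3] -/
def labelMap (g : Λ → Λ) (I : CIdx Λ N ⊕ₗ CIdx Λ N) : CIdx Λ N ⊕ₗ CIdx Λ N :=
  Sum.elim (fun p => barIdx (cidx (g (ofLex p).1) (ofLex p).2))
    (fun p => psiIdx (cidx (g (ofLex p).1) (ofLex p).2)) (ofLex I)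

omit [LinearOrder Λ] in
/-- `labelMap` on `ψ̄_a(x)`. [cite: Berezin1966, Ch. I §3] -/
@[simp] theorem labelMap_barIdx (g : Λ → Λ) (x : Λ) (a : Fin N) :
    labelMap g (barIdx (cidx x a)) = barIdx (cidx (g x) a) := rfl

omit [LinearOrder Λ] in
/-- `labelMap` on `ψ_a(x)`. [cite: Berezin1966, Ch. I §3] -/
@[simp] theorem labelMap_psiIdx (g : Λ → Λ) (x : Λ) (a : Fin N) :
    labelMap g (psiIdx (cidx x a)) = psiIdx (cidx (g x) a) := rfl

omit [LinearOrder Λ] in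
/-- `labelMap` is functorial. [cite: Berezin1966, Ch. I §3] -/
theorem labelMap_labelMap (g h : Λ → Λ) (I : CIdx Λ N ⊕ₗ CIdx Λ N) :
    labelMap g (labelMap h I) = labelMap (g ∘ h) I := by
  obtain ⟨j, rfl⟩ : ∃ j, toLex j = I := ⟨ofLex I, rfl⟩
  rcases j with p | p <;> rfl

omit [LinearOrder Λ] in
/-- `labelMap id = id`. [cite: Berezin1966, Ch. I §3] -/
theorem labelMap_id (I : CIdx Λ N ⊕ₗ CIdx Λ N) : labelMap (N := N) (id : Λ → Λ) I = I := by
  obtain ⟨j, rfl⟩ : ∃ j, toLex j = I := ⟨ofLex I, rfl⟩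
  rcases j with p | p <;> rfl

omit [LinearOrder Λ] in
/-- The site of a relabelled index. [cite: Berezin1966, Ch. I §3] -/
theorem idxSite_labelMap (g : Λ → Λ) (I : CIdx Λ N ⊕ₗ CIdx Λ N) : idxSite (labelMap g I) = g (idxSite I) := by
  obtain ⟨j, rfl⟩ : ∃ j, toLex j = I := ⟨ofLex I, rfl⟩
  rcases j with p | p <;> rfl

/-- **The substitution of generators** `v ↦ (I ↦ s(g⁻¹·site I) v(g⁻¹ I))` whose induced algebra map is
`ψ_a(x) ↦ s(x) ψ_a(gx)`. [cite: Berezin1966, Ch. I §3] -/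
def siteSubst (g : Λ ≃ Λ) (s : Λ → ℂ) : (CIdx Λ N ⊕ₗ CIdx Λ N → ℂ) →ₗ[ℂ] (CIdx Λ N ⊕ₗ CIdx Λ N → ℂ) where
  toFun v := fun I => s (idxSite (labelMap g.symm I)) * v (labelMap g.symm I)
  map_add' v w := by funext I; simp only [Pi.add_apply]; ring
  map_smul' a v := by funext I; simp only [Pi.smul_apply, smul_eq_mul, RingHom.id_apply]; ring

/-- The substitution on a basis vector. [cite: Berezin1966, Ch. I §3] -/
theorem siteSubst_single (g : Λ ≃ Λ) (s : Λ → ℂ) (I : CIdx Λ N ⊕ₗ CIdx Λ N) :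
    siteSubst g s (Pi.single I 1) = s (idxSite I) • Pi.single (labelMap g I) 1 := by
  funext I'
  simp only [siteSubst, LinearMap.coe_mk, AddHom.coe_mk, Pi.smul_apply, smul_eq_mul, Pi.single_apply]
  have hgg : ∀ J, labelMap (N := N) g.symm (labelMap g J) = J := fun J => by
    rw [labelMap_labelMap, g.symm_comp_self, labelMap_id]
  have hgg' : ∀ J, labelMap (N := N) g (labelMap g.symm J) = J := fun J => by
    rw [labelMap_labelMap, g.self_comp_symm, labelMap_id]
  by_cases h : I' = labelMap g I
  · subst h
    rw [hgg, if_pos rfl, if_pos rfl]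
  · have h2 : labelMap g.symm I' ≠ I := fun h' => h (by rw [← h', hgg'])
    rw [if_neg h, if_neg h2, mul_zero, mul_zero]

variable (N) in
/-- **The site relabelling** `ρ_{g,s}` of the fermion algebra: the algebra homomorphism
`ψ_a(x) ↦ s(x) ψ_a(gx)`, `ψ̄_a(x) ↦ s(x) ψ̄_a(gx)`. [cite: Berezin1966, Ch. I §3] -/
abbrev siteRelabel (g : Λ ≃ Λ) (s : Λ → ℂ) : FermiAlg Λ N →ₐ[ℂ] FermiAlg Λ N :=
  ExteriorAlgebra.map (siteSubst (N := N) g s)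

/-- `ρ` on a generator. [cite: Berezin1966, Ch. I §3] -/
theorem siteRelabel_gen (g : Λ ≃ Λ) (s : Λ → ℂ) (I : CIdx Λ N ⊕ₗ CIdx Λ N) :
    siteRelabel N g s (gen ℂ I) = s (idxSite I) • gen ℂ (labelMap g I) := by
  rw [gen, ExteriorAlgebra.map_apply_ι, siteSubst_single, map_smul, gen]

/-- `ρ(ψ̄_a(x)) = s(x) ψ̄_a(gx)`. [cite: Berezin1966, Ch. I §3] -/
theorem siteRelabel_psiBar (g : Λ ≃ Λ) (s : Λ → ℂ) (x : Λ) (a : Fin N) :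
    siteRelabel N g s (psiBar ℂ (cidx x a)) = s x • psiBar ℂ (cidx (g x) a) :=
  siteRelabel_gen g s (barIdx (cidx x a))

/-- `ρ(ψ_a(x)) = s(x) ψ_a(gx)`. [cite: Berezin1966, Ch. I §3] -/
theorem siteRelabel_psi (g : Λ ≃ Λ) (s : Λ → ℂ) (x : Λ) (a : Fin N) :
    siteRelabel N g s (psi ℂ (cidx x a)) = s x • psi ℂ (cidx (g x) a) :=
  siteRelabel_gen g s (psiIdx (cidx x a))

/-- `ρ(ψ̄_a(x)ψ_b(y)) = s(x)s(y) ψ̄_a(gx)ψ_b(gy)`. [cite: Berezin1966, Ch. I §3] -/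
theorem siteRelabel_pair (g : Λ ≃ Λ) (s : Λ → ℂ) (x y : Λ) (a b : Fin N) :
    siteRelabel N g s (pair (cidx x a) (cidx y b)) = (s x * s y) • pair (cidx (g x) a) (cidx (g y) b) := by
  rw [pair, map_mul, siteRelabel_psiBar, siteRelabel_psi, smul_mul_smul_comm]

/-- `ρ(ψ̄ψ(x)) = ψ̄ψ(gx)` for a sign gauge (`s² = 1`). [cite: MontvayMunster1994, §4.3 (4.186)–(4.187)] -/
theorem siteRelabel_meson (g : Λ ≃ Λ) {s : Λ → ℂ} (hs : ∀ x, s x * s x = 1) (x : Λ) :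
    siteRelabel N g s (meson x) = meson (g x) := by
  rw [meson, meson, map_sum]
  exact Finset.sum_congr rfl fun a _ => by rw [siteRelabel_pair, hs, one_smul]

/-- `ρ(ψ̄(x)Vψ(y)) = s(x)s(y) ψ̄(gx)Vψ(gy)`. [cite: MontvayMunster1994, §4.3 (4.186)–(4.187)] -/
theorem siteRelabel_hopAt (g : Λ ≃ Λ) (s : Λ → ℂ) (x y : Λ) (V : Matrix (Fin N) (Fin N) ℂ) :
    siteRelabel N g s (hopAt x y V) = (s x * s y) • hopAt (g x) (g y) V := by
  unfold hopAt
  rw [map_sum, Finset.smul_sum]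
  refine Finset.sum_congr rfl fun a _ => ?_
  rw [map_sum, Finset.smul_sum]
  refine Finset.sum_congr rfl fun b _ => ?_
  rw [map_smul, siteRelabel_pair, smul_comm]

variable [Fintype Λ] in
/-- The Berezin integral of a relabelled element is `det ρ` times the original. [cite: Berezin1966, Ch. I §3] -/
theorem berezin_siteRelabel (g : Λ ≃ Λ) (s : Λ → ℂ) (X : FermiAlg Λ N) :
    berezin ℂ _ (siteRelabel N g s X) = LinearMap.det (siteSubst (N := N) g s) * berezin ℂ _ X :=
  berezin_map ℂ _ X

end Relabel

/-! ### The bosonisation intertwines the relabelling with `rename` -/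

variable {N ν L : ℕ} [NeZero L] [LinearOrder (TorusSite ν L)]

omit [NeZero L] in
/-- `bos (P ∘ g) = ρ_{g,s}(bos P)` for a sign gauge `s`. [cite: SalmhoferSeiler1991, §2 (2.20)] -/
theorem siteRelabel_bos (g : TorusSite ν L ≃ TorusSite ν L) {s : TorusSite ν L → ℂ} (hs : ∀ x, s x * s x = 1)
    (P : MvPolynomial (TorusSite ν L) ℂ) :
    siteRelabel N g s (bos N P) = bos N (rename g P) := by
  induction P using MvPolynomial.induction_on with
  | C a => rw [rename_C, bos_C, AlgHom.commutes]
  | add p q hp hq => rw [map_add, bos_add, bos_add, map_add, hp, hq]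
  | mul_X p x hp =>
    rw [map_mul, rename_X, bos_mul, bos_mul, map_mul, hp, bos_X, bos_X, map_smul, siteRelabel_meson g hs]

/-! ### Translations -/

variable (N) in
/-- **The translation by `c` with the staggered shift sign**: `ψ_a(x) ↦ ζ_c(x) ψ_a(x + c)`. [cite: MontvayMunster1994, §4.3 (4.186)–(4.187)] -/
abbrev translateF (c : TorusSite ν L) : FermiAlg (TorusSite ν L) N →ₐ[ℂ] FermiAlg (TorusSite ν L) N :=
  siteRelabel N (Equiv.addRight c) (fun x => ((shiftSign c x : ℤ) : ℂ))

/-- **The shifted action is the action in the translated gauge field**, bond by bond: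
`ρ_c(A_b(U_b)) = A_{b+c}((τ_cU)_{b+c})`. [cite: MontvayMunster1994, §4.3 (4.186)–(4.187)] -/
theorem translateF_bondTerm (hL : Even L) (c : TorusSite ν L) (U : GaugeConfig ν L (UN N)) (b : TorusSite ν L × Fin ν) :
    translateF N c (StrongCoupling.bondTerm (torusLinks ν L) (stagSigns ν L) U b) =
      StrongCoupling.bondTerm (torusLinks ν L) (stagSigns ν L) (torusConfigShift c U) (torusEdgeShift c b) := by
  obtain ⟨x, μ⟩ := b
  have hph := phase_add_eq_shiftSign_mul hL c x μ
  simp only [StrongCoupling.bondTerm, torusLinks, torusEdgeShift_apply, torusConfigShift_apply, add_sub_cancel_right,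
    map_add, map_smul, siteRelabel_hopAt, Equiv.coe_addRight, stagSigns, smul_smul, add_right_comm x _ c, hph]
  congr 1
  · congr 1; ring
  · congr 1; ring

/-- `ρ_c(A(U)) = A(τ_cU)` for the massless periodic staggered action. [cite: MontvayMunster1994, §4.3 (4.186)–(4.187)] -/
theorem translateF_actionOn (hL : Even L) (c : TorusSite ν L) (U : GaugeConfig ν L (UN N)) :
    translateF N c (actionOn Finset.univ (torusLinks ν L) (stagSigns ν L) U) =
      actionOn Finset.univ (torusLinks ν L) (stagSigns ν L) (torusConfigShift c U) := by
  rw [actionOn, actionOn, map_sum]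
  simp_rw [translateF_bondTerm hL]
  exact Fintype.sum_equiv (torusEdgeShift c) _ _ fun b => rfl

/-- `ρ_c(e^{A(U)}) = e^{A(τ_cU)}`. [cite: MontvayMunster1994, §4.3 (4.186)–(4.187)] -/
theorem translateF_fermiW (hL : Even L) (c : TorusSite ν L) (U : GaugeConfig ν L (UN N)) :
    translateF N c (fermiW U) = fermiW (torusConfigShift c U) := by
  rw [show fermiW U = grassmannExp (actionOn Finset.univ (torusLinks ν L) (stagSigns ν L) U) from rfl,
    map_grassmannExp_eq, translateF_actionOn hL]

omit [LinearOrder (TorusSite ν L)] in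
/-- `∏dU` is translation invariant. [cite: SalmhoferSeiler1991, §2 (2.12)] -/
theorem measurePreserving_torusConfigShift (c : TorusSite ν L) :
    MeasurePreserving (torusConfigShift c) (haarPi N ν L) (haarPi N ν L) :=
  measurePreserving_arrowCongr' (fun _ : Edge ν L => Literature.MathematicalPhysics.QuantumFieldTheory.haarProbability (UN N))
    (fun _ => Literature.MathematicalPhysics.QuantumFieldTheory.haarProbability (UN N)) (torusEdgeShift c)
    (MeasurableEquiv.refl _) fun _ => MeasurePreserving.id _

/-- **`J_β(ρ_c G) = det ρ_c · J_β(G)`** (translation invariance of `∏dU` and of the plaquette weight). [cite: SalmhoferSeiler1991, §2 (2.9)–(2.12)] -/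
theorem sdJ_translateF (hL : Even L) (β : ℝ) (c : TorusSite ν L) (G : FermiAlg (TorusSite ν L) N) :
    sdJ N ν L β (translateF N c G) =
      LinearMap.det (siteSubst (N := N) (Equiv.addRight c) (fun x => ((shiftSign c x : ℤ) : ℂ))) * sdJ N ν L β G := by
  rw [sdJ, sdJ, ← integral_const_mul,
    ← (measurePreserving_torusConfigShift (N := N) c).integral_comp (torusConfigShift c).measurableEmbedding]
  refine integral_congr_ae (ae_of_all _ fun V => ?_)
  dsimp only
  rw [plaq, plaq, wilsonAction_torusConfigShift, ← translateF_fermiW hL, ← map_mul, berezin_siteRelabel]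
  ring

/-- **`det ρ_c = 1`** (test `J_β(ρ_c 1) = det ρ_c · J_β(1)` with `J_β(1) ≠ 0`). [cite: Berezin1966, Ch. I §3] -/
theorem det_translate_eq_one [NeZero ν] (hL : Even L) (c : TorusSite ν L) :
    LinearMap.det (siteSubst (N := N) (Equiv.addRight c) (fun x => ((shiftSign c x : ℤ) : ℂ))) = 1 := by
  have h := sdJ_translateF (N := N) hL 0 c 1
  rw [map_one] at h
  have h1 : sdJ N ν L 0 (1 : FermiAlg (TorusSite ν L) N) ≠ 0 := by
    rw [sdJ_one_eq hL]
    exact mul_ne_zero (fun h0 => by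
      have := chiralSign_mul_self (N := N) (evens ν L); rw [h0, zero_mul] at this; exact zero_ne_one this)
      (Complex.ofReal_ne_zero.2 (sdS_one_pos hL 0).ne')
  exact (mul_eq_right₀ h1).1 h.symm

/-- **THE MESON MOMENTS ARE TRANSLATION INVARIANT**: `w_β(m ∘ τ_c) = w_β(m)` — hypothesis `hT` of
`…MesonWeightInfraredBound`, discharged. [cite: SalmhoferSeiler1991, (3.100); MontvayMunster1994, §4.3] -/
theorem mesonMoment_mapDomain_addRight [NeZero ν] (hL : Even L) (β : ℝ) (c : TorusSite ν L) (m : TorusSite ν L →₀ ℕ) :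
    mesonMoment N ν L β (Finsupp.mapDomain (Equiv.addRight c) m) = mesonMoment N ν L β m := by
  rw [mesonMoment, mesonMoment, ← rename_monomial, ← siteRelabel_bos (Equiv.addRight c) (cast_shiftSign_mul_self c),
    sdJ_translateF hL, det_translate_eq_one hL, one_mul]

end MesonWeight

end Summit.Ventures.YMGap.Conjectures

end
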